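import Summits.AtomisticToContinuum.FouriersLaw.Theses.BondHeatUncertainty
import Summits.AtomisticToContinuum.FouriersLaw.Theorems.ExtensiveSnapshotIrreversibility.Negative.LoadBearingHypotheses
import Summits.AtomisticToContinuum.FouriersLaw.Theorems.ExtensiveSnapshotIrreversibility.Negative.DegenerateInstances

/-!
# Line `clausius-budget-sound-window` — lead's skeleton (v2) for the crux
`BondHeatUncertainty.ExtensiveSnapshotIrreversibility` (item stmt-AtomisticToContinuum-9121)

Lead prover-line-stmt-AtomisticToContinuum-9121-0, 2026-08-16. Reshaped from the planner's checked skeleton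
`Cruxes/ExtensiveSnapshotIrreversibility/Lines/clausius-budget-sound-window.lean` (same line, same composition idea:
window split of the McLennan corrector at `τ ≤ cN`, Clausius budget for the window, late odd response for the rest,
fixed-`N` KL identification; `N = 0, 1` by the landed degenerate instances). What changed and why:

* NO LOCAL DEFINITIONS: every stub is stated in tree vocabulary only (`pinnedChain`, `transitionKernel`, `gibbsMeasure`,
  `hamiltonian`, `IsSteadyState`, Mathlib `MemLp` / `klDiv` / `Measure.bind`), the line's objects being `let`-bound
  inside each signature (`g` source, `Pg s` its equilibrium evolution, `k τ` window response, `w` McLennan corrector,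
  `Pw τ` evolved corrector, `μT` Gibbs at the mean temperature) — so that each stub can be landed verbatim under
  `Theorems/` (which cannot import `Cruxes/`) with `--supports stmt-AtomisticToContinuum-9121`.
* THE COMMON KERNEL DEBT IS A STUB, PAID IN-TREE UNDER THE GUARD (`stub_equilibriumKernelFacts`, S0): under weak-NESS
  uniqueness the Gibbs measure `μ_T` IS the Krylov–Bogoliubov invariant probability measure of the constructed
  equilibrium kernels (`pinnedChainSemigroup_exists_isInvariant` + `IsInvariant.isSteadyState` + the guard +
  `pinnedChain_isSteadyState_gibbsMeasure`; H2 is PROVED: `CuneoEckmannHairerReyBellet2018_H2_holds`), hence (i) `μ_T`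
  is invariant for `transitionKernel N T T t`, and (ii) CEHR (2.5) exponential convergence to `μ_T(f)` in the
  `e^{ϑH}`-weighted norm holds (`pinnedChainSemigroup_exp_convergence`, minorisation Hörmander-free via
  `pinnedChain_localSmall` / `pinnedChain_minorization_of_localSmall`). Every other stub takes (i), (ii) as HYPOTHESES
  (discharged by S0 in the composition), never re-derives them.
* S2 of the planner is split at the skeleton level into S2a `stub_correctorIntegrability` (absolute convergence of the
  McLennan integral, `L²(μ_T)` membership of `w`, `k τ`, `P_τ w`, and the POINTWISE window identity `w = k τ + P_τ w`)
  and S2b `stub_correctorCocycle` (Minkowski + flip-invariance of `μ_T` ⇒ `√D(w) ≤ 2‖k τ‖ + √D(P_τ w)`).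
* S3 of the planner is split into S3a `stub_gibbsContactCalculus` (STATIC, provable now: the `L²(μ_T)` Dirichlet form of
  the equilibrium generator on `C_c^∞` is the Ornstein–Uhlenbeck form of the two contact momenta — the Liouville part is
  antisymmetric — and the Gaussian integration by parts `⟨p_i² − T, f⟩ = T⟨p_i, ∂_{p_i} f⟩`) and S3b
  `stub_clausiusBudget` (the DYNAMIC lever `‖k τ‖² ≤ γτ/(4T²)`, taking S3a, (i), (ii) and `k τ ∈ L²` as hypotheses).
* All `N`-uniform / family statements carry the uniqueness guard of the crux (costless: the composition has it).

Registered stubs (7 = stubs_max): S0 `stub_equilibriumKernelFacts`, S1 `stub_klExpansion`, S2a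
`stub_correctorIntegrability`, S2b `stub_correctorCocycle`, S3a `stub_gibbsContactCalculus`, S3b `stub_clausiusBudget`,
S4 `stub_lateOddResponse` (HARDEST, the lead's). `ExtensiveSnapshotIrreversibility_of` concludes the crux BY NAME; its
arithmetic core `concl_of_parts` is abstract real arithmetic (sorry-free in closure).

Disproof.lean (cdisprove cycles 1–2, NO KILL) honoured exactly as in the planner's skeleton: family hypothesis used (S1,
`N = 0,1` glue), `0 < T` everywhere (`T⁻²` constants, Disproof §4 `StrengtheningUniformT`), eventual-in-`δ` only
(`false_withAllDelta`), `C·N` never `o(N)` (harmonic corner `K_N = N/6 − 2/9` carried by S4).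
-/

noncomputable section

namespace Summit.AtomisticToContinuum.FouriersLaw.Cruxes.ExtensiveSnapshotIrreversibility.ClausiusBudgetSoundWindow

open MeasureTheory Filter Topology InformationTheory
open scoped ENNReal NNReal
open Literature.MathematicalPhysics.KineticTheory.HeatConduction
open Summit.AtomisticToContinuum.FouriersLaw.Theses.BondHeatUncertainty
open Summit.AtomisticToContinuum.FouriersLaw.Theorems.ExtensiveSnapshotIrreversibility.Negative

/-! ## Stubs (`sorry` only here)

Common `let`-dictionary inside the signatures (for `P = pinnedChain ω₂ lam β γ`, `N ≥ 2`, `T > 0`):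
`μT := P.gibbsMeasure N T`; `g y := γ/(2T²)·(p_0² − p_{N−1}²)` (the SOURCE); `Pg s z := ∫ g d(P.transitionKernel N T T s z)`
(`s : ℝ`, read through `Real.toNNReal`); `k τ z := ∫₀^τ Pg s z ds` (WINDOW RESPONSE); `w z := ∫_{s>0} Pg s z ds` (McLENNAN
CORRECTOR, improper Bochner integral); `Pw τ z := ∫ w d(P.transitionKernel N T T τ z)` (evolved corrector); flip `Θ z = (z.1, −z.2)`.
Hypothesis blocks: (INV) `∀ t, μT.bind (P.transitionKernel N T T t) = μT`; (MIX) CEHR (2.5) at equilibrium: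
`∀ ϑ ∈ (0, 1/T) ∃ C c > 0 ∀ z t f`, `f` continuous with `|f| ≤ e^{ϑH}` ⇒ `|P_t f(z) − μT(f)| ≤ C e^{ϑH(z)} e^{−ct}`. -/

/-- **S0 `stub_equilibriumKernelFacts`** (fixed `N ≥ 1`, size M, provable from the tree). Under weak-NESS uniqueness,
for `T > 0`: (INV) the Gibbs measure at `T` is invariant for the constructed equilibrium kernels `transitionKernel N T T t`,
and (MIX) the equilibrium semigroup converges exponentially to `μ_T(f)` in the `e^{ϑH}`-weighted norm for every
`0 < ϑ < 1/T`. Proof route: `pinnedChainSemigroup_exists_isInvariant CuneoEckmannHairerReyBellet2018_H2_holds` gives a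
Krylov–Bogoliubov invariant probability measure `μ⋆` of `pinnedChainSemigroup` (kernels = `transitionKernel`, simp lemma
`pinnedChainSemigroup_kernel`); `LangevinChainSemigroup.IsInvariant.isSteadyState` makes it a weak steady state at
`(T, T)`; the guard and `pinnedChain_isSteadyState_gibbsMeasure` give `μ⋆ = gibbsMeasure N T`; (MIX) is
`pinnedChainSemigroup_exp_convergence` with `h36 := pinnedChain_minorization_of_localSmall … pinnedChain_localSmall`
(`max T T = T`). -/
theorem stub_equilibriumKernelFacts :
    ∀ ω₂ lam β γ : ℝ, 0 < ω₂ → 0 < lam → 0 < β → 0 < γ →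
      (∀ (N : ℕ) (T_L T_R : ℝ), 0 < T_L → 0 < T_R → ∀ μ ν : Measure (PhaseSpace N),
        (pinnedChain ω₂ lam β γ).IsSteadyState N T_L T_R μ →
        (pinnedChain ω₂ lam β γ).IsSteadyState N T_L T_R ν → μ = ν) →
      ∀ T : ℝ, 0 < T → ∀ N : ℕ, 0 < N →
        let P := pinnedChain ω₂ lam β γ
        let μT := P.gibbsMeasure N T
        (∀ t : ℝ≥0, μT.bind (P.transitionKernel N T T t) = μT) ∧
        (∀ ϑ : ℝ, 0 < ϑ → ϑ < 1 / T → ∃ C c : ℝ, 0 < C ∧ 0 < c ∧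
          ∀ (z : PhaseSpace N) (t : ℝ≥0) (f : PhaseSpace N → ℝ), Continuous f →
            (∀ y, |f y| ≤ Real.exp (ϑ * P.hamiltonian N y)) →
            |(∫ y, f y ∂(P.transitionKernel N T T t z)) - ∫ y, f y ∂μT| ≤
              C * Real.exp (ϑ * P.hamiltonian N z) * Real.exp (-c * t)) := by
  sorry

/-- **S1 `stub_klExpansion`** (fixed `N ≥ 2`, size L; the fixed-`N` debt shared by every line of this crux, Disproof §7).
Under the guard, along every steady-state family, for `T > 0`, `N ≥ 2`, given (INV), (MIX) and `w ∈ L²(μ_T)`: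
for every `ε > 0`, eventually as `δ → 0` (`δ ≠ 0`), `KL(μ_{N,T+δ/2,T−δ/2} ‖ Θ_*μ_{N,T+δ/2,T−δ/2}) ≤ (½D(w) + ε)δ²`,
`D(w) = ∫ (w − w∘Θ)² dμ_T`. Content: `μ_{N,T,T} = μ_T` (guard + `pinnedChain_isSteadyState_gibbsMeasure`); a response
density `h ∈ L²(μ_T)` exists with `L_T†h = −g` weakly and equals the McLennan form `w∘Θ` (`P_s† = ΘP_sΘ`, `Θg = g`;
MaesNetocny2010); `KL = ½δ²D(h) + o(δ²)` incl. FINITENESS of `KL` for small `δ` (two-sided NESS density control,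
"not in print" — Disproof) — sibling items OddSectorIrreversibility.ResponseDensity (9144) / ReversalKLSecondOrder
(9145) / OddDensityIsCorrector (9146, `g`-picture). -/
theorem stub_klExpansion :
    ∀ ω₂ lam β γ : ℝ, 0 < ω₂ → 0 < lam → 0 < β → 0 < γ →
      (∀ (N : ℕ) (T_L T_R : ℝ), 0 < T_L → 0 < T_R → ∀ μ ν : Measure (PhaseSpace N),
        (pinnedChain ω₂ lam β γ).IsSteadyState N T_L T_R μ →
        (pinnedChain ω₂ lam β γ).IsSteadyState N T_L T_R ν → μ = ν) →
      ∀ μ : (N : ℕ) → ℝ → ℝ → Measure (PhaseSpace N),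
        (∀ (N : ℕ) (T_L T_R : ℝ), 0 < T_L → 0 < T_R →
          (pinnedChain ω₂ lam β γ).IsSteadyState N T_L T_R (μ N T_L T_R)) →
        ∀ T : ℝ, 0 < T → ∀ (N : ℕ) (hN : 2 ≤ N),
          let P := pinnedChain ω₂ lam β γ
          let μT := P.gibbsMeasure N T
          (∀ t : ℝ≥0, μT.bind (P.transitionKernel N T T t) = μT) →
          (∀ ϑ : ℝ, 0 < ϑ → ϑ < 1 / T → ∃ C c : ℝ, 0 < C ∧ 0 < c ∧
            ∀ (z : PhaseSpace N) (t : ℝ≥0) (f : PhaseSpace N → ℝ), Continuous f →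
              (∀ y, |f y| ≤ Real.exp (ϑ * P.hamiltonian N y)) →
              |(∫ y, f y ∂(P.transitionKernel N T T t z)) - ∫ y, f y ∂μT| ≤
                C * Real.exp (ϑ * P.hamiltonian N z) * Real.exp (-c * t)) →
          let g : PhaseSpace N → ℝ := fun y =>
            γ / (2 * T ^ 2) * (y.2 ⟨0, by omega⟩ ^ 2 - y.2 ⟨N - 1, by omega⟩ ^ 2)
          let Pg : ℝ → PhaseSpace N → ℝ := fun s z => ∫ y, g y ∂(P.transitionKernel N T T s.toNNReal z)
          let w : PhaseSpace N → ℝ := fun z => ∫ s in Set.Ioi (0 : ℝ), Pg s z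
          MemLp w 2 μT →
          ∀ ε : ℝ, 0 < ε →
            ∀ᶠ δ in 𝓝[≠] (0 : ℝ),
              klDiv (μ N (T + δ / 2) (T - δ / 2))
                  (Measure.map (fun x : PhaseSpace N => (x.1, -x.2)) (μ N (T + δ / 2) (T - δ / 2)))
                ≤ ENNReal.ofReal (((∫ z, (w z - w (z.1, -z.2)) ^ 2 ∂μT) / 2 + ε) * δ ^ 2) := by
  sorry

/-- **S2a `stub_correctorIntegrability`** (fixed `N ≥ 2`, size M/L, provable now). Given (INV) and (MIX): the McLennan
integral converges absolutely for every starting point, `w`, `k τ`, `P_τ w ∈ L²(μ_T)`, and the WINDOW IDENTITY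
`w = k τ + P_τ w` holds POINTWISE for every `τ ≥ 0`. Why true: `|g| ≤ (γ/T²)(1/ϑ)e^{ϑH}` (`H ≥ 0`,
`pinnedChain_hamiltonian_nonneg`) and `μ_T(g) = 0` (the two contact momenta are identically distributed under `μ_T`:
reflection symmetry of the Gibbs density / `p_i ~ N(0,T)` given `q`), so (MIX) with `ϑ = 1/(4T)` gives
`|Pg s z| ≤ C' e^{ϑH(z)} e^{−cs}`: integrable in `s`; `|w z| ≤ (C'/c) e^{ϑH(z)}` with `e^{2ϑH} ∈ L¹(μ_T)`
(`pinnedChain_integrable_exp_mul_hamiltonian_gibbsMeasure`, `2ϑ < 1/T`); `∫_{s>τ} Pg s z ds = ∫_{u>0} Pg (τ+u) z du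
= ∫ (∫_{u>0} Pg u x du) d(κ_τ z)(x) = P_τ w (z)` by Chapman–Kolmogorov (`pinnedChain_transitionKernel_add`) and Fubini
(integrable majorant `(C'/c) e^{ϑH(x)}`, `∫ e^{ϑH} dκ_τ(z) ≤ e^{2ϑγTτ} e^{ϑH(z)}`:
`lintegral_exp_mul_hamiltonian_pinnedChainSemigroup_le`); measurability from `pinnedChain_measurable_transitionKernel` /
`stronglyMeasurable_uncurry_act`. -/
theorem stub_correctorIntegrability :
    ∀ ω₂ lam β γ : ℝ, 0 < ω₂ → 0 < lam → 0 < β → 0 < γ → ∀ T : ℝ, 0 < T → ∀ (N : ℕ) (hN : 2 ≤ N),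
      let P := pinnedChain ω₂ lam β γ
      let μT := P.gibbsMeasure N T
      (∀ t : ℝ≥0, μT.bind (P.transitionKernel N T T t) = μT) →
      (∀ ϑ : ℝ, 0 < ϑ → ϑ < 1 / T → ∃ C c : ℝ, 0 < C ∧ 0 < c ∧
        ∀ (z : PhaseSpace N) (t : ℝ≥0) (f : PhaseSpace N → ℝ), Continuous f →
          (∀ y, |f y| ≤ Real.exp (ϑ * P.hamiltonian N y)) →
          |(∫ y, f y ∂(P.transitionKernel N T T t z)) - ∫ y, f y ∂μT| ≤
            C * Real.exp (ϑ * P.hamiltonian N z) * Real.exp (-c * t)) →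
      let g : PhaseSpace N → ℝ := fun y =>
        γ / (2 * T ^ 2) * (y.2 ⟨0, by omega⟩ ^ 2 - y.2 ⟨N - 1, by omega⟩ ^ 2)
      let Pg : ℝ → PhaseSpace N → ℝ := fun s z => ∫ y, g y ∂(P.transitionKernel N T T s.toNNReal z)
      let k : ℝ → PhaseSpace N → ℝ := fun τ z => ∫ s in (0 : ℝ)..τ, Pg s z
      let w : PhaseSpace N → ℝ := fun z => ∫ s in Set.Ioi (0 : ℝ), Pg s z
      let Pw : ℝ → PhaseSpace N → ℝ := fun τ z => ∫ x, w x ∂(P.transitionKernel N T T τ.toNNReal z)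
      (∀ z : PhaseSpace N, IntegrableOn (fun s => Pg s z) (Set.Ioi (0 : ℝ))) ∧
      MemLp w 2 μT ∧
      ∀ τ : ℝ, 0 ≤ τ → MemLp (k τ) 2 μT ∧ MemLp (Pw τ) 2 μT ∧ ∀ z : PhaseSpace N, w z = k τ z + Pw τ z := by
  sorry

/-- **S2b `stub_correctorCocycle`** (fixed `N`, size M, provable now; pure `L²(μ_T)` bookkeeping). For `T > 0`, `τ`, and
functions `w, kτ, Pwτ ∈ L²(μ_T)` with `w = kτ + Pwτ` pointwise:
`√∫(w − w∘Θ)² dμ_T ≤ 2√∫kτ² dμ_T + √∫(Pwτ − Pwτ∘Θ)² dμ_T` — Minkowski in `L²(μ_T)` and `‖kτ∘Θ‖ = ‖kτ‖` by the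
flip-invariance of the Gibbs measure (`gibbsMeasure_map_flip`, landed in Negative/DegenerateInstances; `integral_map`).
Stated for ARBITRARY functions (the line instantiates `w, k τ, Pw τ` of S2a), so no kernel enters. -/
theorem stub_correctorCocycle :
    ∀ ω₂ lam β γ : ℝ, 0 < ω₂ → 0 < lam → 0 < β → 0 < γ → ∀ T : ℝ, 0 < T → ∀ (N : ℕ),
      ∀ w kτ Pwτ : PhaseSpace N → ℝ,
        MemLp w 2 ((pinnedChain ω₂ lam β γ).gibbsMeasure N T) →
        MemLp kτ 2 ((pinnedChain ω₂ lam β γ).gibbsMeasure N T) →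
        MemLp Pwτ 2 ((pinnedChain ω₂ lam β γ).gibbsMeasure N T) →
        (∀ z : PhaseSpace N, w z = kτ z + Pwτ z) →
        Real.sqrt (∫ z, (w z - w (z.1, -z.2)) ^ 2 ∂((pinnedChain ω₂ lam β γ).gibbsMeasure N T)) ≤
          2 * Real.sqrt (∫ z, (kτ z) ^ 2 ∂((pinnedChain ω₂ lam β γ).gibbsMeasure N T)) +
            Real.sqrt (∫ z, (Pwτ z - Pwτ (z.1, -z.2)) ^ 2 ∂((pinnedChain ω₂ lam β γ).gibbsMeasure N T)) := by
  sorry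

/-- **S3a `stub_gibbsContactCalculus`** (STATIC, every `N ≥ 1`, size M, provable now from `integral_liouville_mul_gibbsDensity`
/ `integral_bath_mul_gibbsDensity` / `integral_mul_eq_neg_of_hasLineDerivAt`). For `T > 0` and every `f ∈ C_c^∞`:
(a) the `L²(μ_T)` DIRICHLET FORM of the equilibrium generator is the Ornstein–Uhlenbeck form of the two contact momenta,
`∫ f · (L_{T,T} f) dμ_T = −γT Σ_i (1[i=0] + 1[i=N−1]) ∫ (∂_{p_i} f)² dμ_T` (the Liouville part is antisymmetric: apply
`∫ L(f²) dμ_T = 0` — Gibbs is steady — and the product rule `L(f²) = 2fLf + 2γ Σ_b T (∂_{p_b}f)²`); (b) GAUSSIAN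
INTEGRATION BY PARTS in a contact momentum: `∫ (p_i² − T) f dμ_T = T ∫ p_i ∂_{p_i} f dμ_T` for every site `i`
(`∂_{p_i} e^{−H/T} = −(p_i/T) e^{−H/T}`). Both are bulk-independent identities; (a)+(b)+Cauchy–Schwarz are the pointwise-in-time
content of the Clausius budget. -/
theorem stub_gibbsContactCalculus :
    ∀ ω₂ lam β γ : ℝ, 0 < ω₂ → 0 < lam → 0 < β → 0 < γ → ∀ T : ℝ, 0 < T → ∀ N : ℕ, 0 < N →
      ∀ f : PhaseSpace N → ℝ, ContDiff ℝ (⊤ : ℕ∞) f → HasCompactSupport f →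
        (∫ x, f x * (pinnedChain ω₂ lam β γ).generator N T T f x ∂((pinnedChain ω₂ lam β γ).gibbsMeasure N T) =
          -(γ * T) * ∑ i : Fin N, ((if i.val = 0 then (1 : ℝ) else 0) + (if i.val = N - 1 then (1 : ℝ) else 0)) *
            ∫ x, (partialP i f x) ^ 2 ∂((pinnedChain ω₂ lam β γ).gibbsMeasure N T)) ∧
        (∀ i : Fin N, ∫ x, (x.2 i ^ 2 - T) * f x ∂((pinnedChain ω₂ lam β γ).gibbsMeasure N T) =
          T * ∫ x, x.2 i * partialP i f x ∂((pinnedChain ω₂ lam β γ).gibbsMeasure N T)) := by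
  sorry

/-- **S3b `stub_clausiusBudget`** (THE LEVER; every `N ≥ 2`, constant free of `N` and of the bulk potentials; size L/XL as a
formalisation). Under the guard, for `T > 0`, given (INV), (MIX), the static contact calculus (a)/(b) of S3a on `C_c^∞`, and
`k τ ∈ L²(μ_T)` for all `τ ≥ 0`: `‖k τ‖²_{L²(μ_T)} ≤ γτ/(4T²)` for every `τ ≥ 0`.
Why true ("the arrow of time can only be pumped at the Clausius rate"): `k_t` solves `d/dt k_t = L_T k_t + g`, `k_0 = 0`;
by (a) `d/dt ½‖k_t‖² = −γT Σ_{i∈∂}‖∂_{p_i}k_t‖² + ⟨g, k_t⟩`, by (b) and Cauchy–Schwarz (`‖p_i‖_{L²(μ_T)} = √T`)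
`|⟨g, k_t⟩| ≤ (γ/2√T)(‖∂_{p_0}k_t‖ + ‖∂_{p_{N−1}}k_t‖)`, hence `d/dt ½‖k_t‖² ≤ 2·max_x(−γTx² + γx/(2√T)) = γ/(8T²)`.
Debt (the formalisation content): extending (a)/(b) from `C_c^∞` to the orbit `k_t` (regularity/growth of `P_s g`, energy
identity for the hypoelliptic semigroup on a core, or a mollified/Steklov version of the argument); harmonic check: max ratio
`0.770–0.814 < 1` (pure OU transient `(1−e^{−2x})²/x ≤ 0.8145`). -/
theorem stub_clausiusBudget :
    ∀ ω₂ lam β γ : ℝ, 0 < ω₂ → 0 < lam → 0 < β → 0 < γ →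
      (∀ (N : ℕ) (T_L T_R : ℝ), 0 < T_L → 0 < T_R → ∀ μ ν : Measure (PhaseSpace N),
        (pinnedChain ω₂ lam β γ).IsSteadyState N T_L T_R μ →
        (pinnedChain ω₂ lam β γ).IsSteadyState N T_L T_R ν → μ = ν) →
      ∀ T : ℝ, 0 < T → ∀ (N : ℕ) (hN : 2 ≤ N),
        let P := pinnedChain ω₂ lam β γ
        let μT := P.gibbsMeasure N T
        (∀ t : ℝ≥0, μT.bind (P.transitionKernel N T T t) = μT) →
        (∀ ϑ : ℝ, 0 < ϑ → ϑ < 1 / T → ∃ C c : ℝ, 0 < C ∧ 0 < c ∧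
          ∀ (z : PhaseSpace N) (t : ℝ≥0) (f : PhaseSpace N → ℝ), Continuous f →
            (∀ y, |f y| ≤ Real.exp (ϑ * P.hamiltonian N y)) →
            |(∫ y, f y ∂(P.transitionKernel N T T t z)) - ∫ y, f y ∂μT| ≤
              C * Real.exp (ϑ * P.hamiltonian N z) * Real.exp (-c * t)) →
        (∀ f : PhaseSpace N → ℝ, ContDiff ℝ (⊤ : ℕ∞) f → HasCompactSupport f →
          (∫ x, f x * P.generator N T T f x ∂μT =
            -(γ * T) * ∑ i : Fin N, ((if i.val = 0 then (1 : ℝ) else 0) + (if i.val = N - 1 then (1 : ℝ) else 0)) *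
              ∫ x, (partialP i f x) ^ 2 ∂μT) ∧
          (∀ i : Fin N, ∫ x, (x.2 i ^ 2 - T) * f x ∂μT = T * ∫ x, x.2 i * partialP i f x ∂μT)) →
        let g : PhaseSpace N → ℝ := fun y =>
          γ / (2 * T ^ 2) * (y.2 ⟨0, by omega⟩ ^ 2 - y.2 ⟨N - 1, by omega⟩ ^ 2)
        let Pg : ℝ → PhaseSpace N → ℝ := fun s z => ∫ y, g y ∂(P.transitionKernel N T T s.toNNReal z)
        let k : ℝ → PhaseSpace N → ℝ := fun τ z => ∫ s in (0 : ℝ)..τ, Pg s z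
        (∀ τ : ℝ, 0 ≤ τ → MemLp (k τ) 2 μT) →
        ∀ τ : ℝ, 0 ≤ τ → ∫ z, (k τ z) ^ 2 ∂μT ≤ γ * τ / (4 * T ^ 2) := by
  sorry

/-- **S4 `stub_lateOddResponse`** (HARDEST, the lead's; the card's residual K1 = transfer target `C⁺`, `N`-uniform). Under
the guard, for `T > 0` there are `C` and `c > 0` such that for every `N ≥ 2`, given (INV) and (MIX), SOME time
`τ ∈ [0, cN]` has `P_τ w ∈ L²(μ_T)` and `D(P_τ w) = ∫ (P_τ w − (P_τ w)∘Θ)² dμ_T ≤ C·N` — the reversal asymmetry of the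
linear response still to arrive AFTER a window of `O(N)` (≍ `c` sound crossings) is at most extensive. Given S0–S3 it is
EQUIVALENT to the crux (no hidden strengthening, no free lunch). Anchors: ballistic corner `D(P_{cN}w)/(4N) ≤ 0.015
(c = 1), 0.0024 (c = 2), 0.0008 (c = 4)`, `N ≤ 24`; diffusive truth-size expected `≪ N`. Sufficient: extensive Fisher
information `‖w‖² ≤ C'N` (sibling card two-bath-fisher-covariance; `D(P_τw) ≤ 4‖P_τ w‖² ≤ 4‖w‖²` by (INV)+Jensen). Why it
might fail: slow odd structures (breather-like trapping near the contacts, band-edge phonons with lifetime `≍ N³` at weak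
anharmonicity) carrying late odd response `≫ N`. -/
theorem stub_lateOddResponse :
    ∀ ω₂ lam β γ : ℝ, 0 < ω₂ → 0 < lam → 0 < β → 0 < γ →
      (∀ (N : ℕ) (T_L T_R : ℝ), 0 < T_L → 0 < T_R → ∀ μ ν : Measure (PhaseSpace N),
        (pinnedChain ω₂ lam β γ).IsSteadyState N T_L T_R μ →
        (pinnedChain ω₂ lam β γ).IsSteadyState N T_L T_R ν → μ = ν) →
      ∀ T : ℝ, 0 < T → ∃ C c : ℝ, 0 < c ∧ ∀ (N : ℕ) (hN : 2 ≤ N),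
        let P := pinnedChain ω₂ lam β γ
        let μT := P.gibbsMeasure N T
        (∀ t : ℝ≥0, μT.bind (P.transitionKernel N T T t) = μT) →
        (∀ ϑ : ℝ, 0 < ϑ → ϑ < 1 / T → ∃ C c : ℝ, 0 < C ∧ 0 < c ∧
          ∀ (z : PhaseSpace N) (t : ℝ≥0) (f : PhaseSpace N → ℝ), Continuous f →
            (∀ y, |f y| ≤ Real.exp (ϑ * P.hamiltonian N y)) →
            |(∫ y, f y ∂(P.transitionKernel N T T t z)) - ∫ y, f y ∂μT| ≤
              C * Real.exp (ϑ * P.hamiltonian N z) * Real.exp (-c * t)) →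
        let g : PhaseSpace N → ℝ := fun y =>
          γ / (2 * T ^ 2) * (y.2 ⟨0, by omega⟩ ^ 2 - y.2 ⟨N - 1, by omega⟩ ^ 2)
        let Pg : ℝ → PhaseSpace N → ℝ := fun s z => ∫ y, g y ∂(P.transitionKernel N T T s.toNNReal z)
        let w : PhaseSpace N → ℝ := fun z => ∫ s in Set.Ioi (0 : ℝ), Pg s z
        let Pw : ℝ → PhaseSpace N → ℝ := fun τ z => ∫ x, w x ∂(P.transitionKernel N T T τ.toNNReal z)
        ∃ τ : ℝ, 0 ≤ τ ∧ τ ≤ c * N ∧ MemLp (Pw τ) 2 μT ∧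
          ∫ z, (Pw τ z - Pw τ (z.1, -z.2)) ^ 2 ∂μT ≤ C * N := by
  sorry

/-! ## Glue (sorry-free) -/

/-- Real arithmetic of the window split: `√D ≤ 2√A' + √B'`, `A' ≤ A`, `B' ≤ B` (all nonnegative) give
`D ≤ 8A + 2B`. -/
theorem sq_bound_of_sqrt_le {D A' B' A B : ℝ} (hD : 0 ≤ D) (hA' : 0 ≤ A') (hB' : 0 ≤ B')
    (hA : A' ≤ A) (hB : B' ≤ B) (h : Real.sqrt D ≤ 2 * Real.sqrt A' + Real.sqrt B') :
    D ≤ 8 * A + 2 * B := by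
  have hsA : Real.sqrt A' ≤ Real.sqrt A := Real.sqrt_le_sqrt hA
  have hsB : Real.sqrt B' ≤ Real.sqrt B := Real.sqrt_le_sqrt hB
  have hA0 : 0 ≤ A := hA'.trans hA
  have hB0 : 0 ≤ B := hB'.trans hB
  have h' : Real.sqrt D ≤ 2 * Real.sqrt A + Real.sqrt B := h.trans (by linarith)
  have h1 : Real.sqrt D * Real.sqrt D ≤ (2 * Real.sqrt A + Real.sqrt B) * (2 * Real.sqrt A + Real.sqrt B) :=
    mul_self_le_mul_self (Real.sqrt_nonneg _) h'
  have hDD : Real.sqrt D * Real.sqrt D = D := Real.mul_self_sqrt hD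
  have hAA : Real.sqrt A * Real.sqrt A = A := Real.mul_self_sqrt hA0
  have hBB : Real.sqrt B * Real.sqrt B = B := Real.mul_self_sqrt hB0
  nlinarith [sq_nonneg (2 * Real.sqrt A - Real.sqrt B), Real.sqrt_nonneg A, Real.sqrt_nonneg B]

/-- **Abstract arithmetic core of the composition.** For one parameter point, one family and one `T > 0`: with
`Dw N` the reversal asymmetry of the corrector, `Wk N τ` the squared window norm and `Dl N τ` the late reversal
asymmetry (any real-valued bookkeeping functions, nonnegative), the four stub-shaped hypotheses give the crux's conclusion
with `C_K = γc/T² + max C 0 + 1`; `N = 0, 1` by the landed Negative lemmas. -/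
theorem concl_of_parts {ω₂ lam β γ : ℝ} (hω : 0 < ω₂) (hl : 0 < lam) (hβ : 0 < β) (hγ : 0 < γ)
    (hU : ∀ (N : ℕ) (T_L T_R : ℝ), 0 < T_L → 0 < T_R → ∀ μ ν : Measure (PhaseSpace N),
      (pinnedChain ω₂ lam β γ).IsSteadyState N T_L T_R μ →
      (pinnedChain ω₂ lam β γ).IsSteadyState N T_L T_R ν → μ = ν)
    {μ : (N : ℕ) → ℝ → ℝ → Measure (PhaseSpace N)}
    (hμ : ∀ (N : ℕ) (T_L T_R : ℝ), 0 < T_L → 0 < T_R →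
      (pinnedChain ω₂ lam β γ).IsSteadyState N T_L T_R (μ N T_L T_R))
    {T : ℝ} (hT : 0 < T) {C c : ℝ} (hc : 0 < c)
    (Dw : ℕ → ℝ) (Wk Dl : ℕ → ℝ → ℝ) (hDw : ∀ N, 0 ≤ Dw N) (hWk : ∀ N τ, 0 ≤ Wk N τ) (hDl : ∀ N τ, 0 ≤ Dl N τ)
    (hKL : ∀ N : ℕ, 2 ≤ N → ∀ ε : ℝ, 0 < ε → ∀ᶠ δ in 𝓝[≠] (0 : ℝ),
      klDiv (μ N (T + δ / 2) (T - δ / 2))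
          (Measure.map (fun x : PhaseSpace N => (x.1, -x.2)) (μ N (T + δ / 2) (T - δ / 2)))
        ≤ ENNReal.ofReal ((Dw N / 2 + ε) * δ ^ 2))
    (hSplit : ∀ N : ℕ, 2 ≤ N → ∀ τ : ℝ, 0 ≤ τ →
      Real.sqrt (Dw N) ≤ 2 * Real.sqrt (Wk N τ) + Real.sqrt (Dl N τ))
    (hBudget : ∀ N : ℕ, 2 ≤ N → ∀ τ : ℝ, 0 ≤ τ → Wk N τ ≤ γ * τ / (4 * T ^ 2))
    (hLate : ∀ N : ℕ, 2 ≤ N → ∃ τ : ℝ, 0 ≤ τ ∧ τ ≤ c * N ∧ Dl N τ ≤ C * N) :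
    ∃ C' : ℝ, ∀ N : ℕ, ∀ᶠ δ in 𝓝[≠] (0 : ℝ),
      klDiv (μ N (T + δ / 2) (T - δ / 2))
          (Measure.map (fun x : PhaseSpace N => (x.1, -x.2)) (μ N (T + δ / 2) (T - δ / 2)))
        ≤ ENNReal.ofReal (C' * (N : ℝ) * δ ^ 2) := by
  refine ⟨γ * c / T ^ 2 + max C 0 + 1, fun N => ?_⟩
  rcases Nat.lt_or_ge N 2 with hN | hN
  · interval_cases N
    · exact extensiveSnapshotIrreversibility_bound_at_zero hμ hT _
    · exact extensiveSnapshotIrreversibility_bound_at_one hω hl hβ hU hμ hT _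
  · have hN0 : (0 : ℝ) ≤ N := by positivity
    have hN1 : (1 : ℝ) ≤ N := by exact_mod_cast (le_trans (by norm_num) hN)
    obtain ⟨τ, hτ0, hτc, hL⟩ := hLate N hN
    have hT2 : 0 < T ^ 2 := by positivity
    have hBτ : Wk N τ ≤ γ * (c * N) / (4 * T ^ 2) :=
      (hBudget N hN τ hτ0).trans
        (div_le_div_of_nonneg_right (mul_le_mul_of_nonneg_left hτc hγ.le) (by positivity))
    have hkey : Dw N ≤ 8 * (γ * (c * N) / (4 * T ^ 2)) + 2 * (max C 0 * N) :=
      sq_bound_of_sqrt_le (hDw N) (hWk N τ) (hDl N τ) hBτ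
        (hL.trans (mul_le_mul_of_nonneg_right (le_max_left _ _) hN0))
        (hSplit N hN τ hτ0)
    filter_upwards [hKL N hN 1 one_pos] with δ hδ
    refine hδ.trans (ENNReal.ofReal_le_ofReal ?_)
    have hδ2 : 0 ≤ δ ^ 2 := sq_nonneg δ
    apply mul_le_mul_of_nonneg_right _ hδ2
    have h8 : 8 * (γ * (c * N) / (4 * T ^ 2)) = 2 * (γ * c / T ^ 2 * N) := by
      field_simp
      ring
    rw [h8] at hkey
    have hgc : 0 ≤ γ * c / T ^ 2 := by positivity
    have hm : 0 ≤ max C 0 := le_max_right _ _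
    nlinarith [hkey, hgc, hm, hN1, mul_nonneg hgc hN0, mul_nonneg hm hN0]

/-- **The composition** — concludes the crux `ExtensiveSnapshotIrreversibility` BY NAME from the seven stubs. -/
theorem ExtensiveSnapshotIrreversibility_of : ExtensiveSnapshotIrreversibility := by
  intro ω₂ lam β γ hω hl hβ hγ hU μ hμ T hT
  obtain ⟨C, c, hc, hLate⟩ := stub_lateOddResponse ω₂ lam β γ hω hl hβ hγ hU T hT
  -- bookkeeping functions (the line's objects at `N`, as real numbers)
  let g : (N : ℕ) → 2 ≤ N → PhaseSpace N → ℝ := fun N hN y =>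
    γ / (2 * T ^ 2) * (y.2 ⟨0, by omega⟩ ^ 2 - y.2 ⟨N - 1, by omega⟩ ^ 2)
  let Pg : (N : ℕ) → 2 ≤ N → ℝ → PhaseSpace N → ℝ := fun N hN s z =>
    ∫ y, g N hN y ∂((pinnedChain ω₂ lam β γ).transitionKernel N T T s.toNNReal z)
  let k : (N : ℕ) → 2 ≤ N → ℝ → PhaseSpace N → ℝ := fun N hN τ z => ∫ s in (0 : ℝ)..τ, Pg N hN s z
  let w : (N : ℕ) → 2 ≤ N → PhaseSpace N → ℝ := fun N hN z => ∫ s in Set.Ioi (0 : ℝ), Pg N hN s z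
  let Pw : (N : ℕ) → 2 ≤ N → ℝ → PhaseSpace N → ℝ := fun N hN τ z =>
    ∫ x, w N hN x ∂((pinnedChain ω₂ lam β γ).transitionKernel N T T τ.toNNReal z)
  let μT : (N : ℕ) → Measure (PhaseSpace N) := fun N => (pinnedChain ω₂ lam β γ).gibbsMeasure N T
  let Dw : ℕ → ℝ := fun N =>
    if hN : 2 ≤ N then ∫ z, (w N hN z - w N hN (z.1, -z.2)) ^ 2 ∂(μT N) else 0
  let Wk : ℕ → ℝ → ℝ := fun N τ => if hN : 2 ≤ N then ∫ z, (k N hN τ z) ^ 2 ∂(μT N) else 0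
  let Dl : ℕ → ℝ → ℝ := fun N τ =>
    if hN : 2 ≤ N then ∫ z, (Pw N hN τ z - Pw N hN τ (z.1, -z.2)) ^ 2 ∂(μT N) else 0
  have hDw : ∀ N, 0 ≤ Dw N := fun N => by
    simp only [Dw]; split_ifs
    · exact integral_nonneg fun _ => sq_nonneg _
    · exact le_rfl
  have hWk : ∀ N τ, 0 ≤ Wk N τ := fun N τ => by
    simp only [Wk]; split_ifs
    · exact integral_nonneg fun _ => sq_nonneg _
    · exact le_rfl
  have hDl : ∀ N τ, 0 ≤ Dl N τ := fun N τ => by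
    simp only [Dl]; split_ifs
    · exact integral_nonneg fun _ => sq_nonneg _
    · exact le_rfl
  -- per-`N` facts from the stubs
  have facts : ∀ N : ℕ, ∀ hN : 2 ≤ N,
      (∀ ε : ℝ, 0 < ε → ∀ᶠ δ in 𝓝[≠] (0 : ℝ),
        klDiv (μ N (T + δ / 2) (T - δ / 2))
            (Measure.map (fun x : PhaseSpace N => (x.1, -x.2)) (μ N (T + δ / 2) (T - δ / 2)))
          ≤ ENNReal.ofReal ((Dw N / 2 + ε) * δ ^ 2)) ∧
      (∀ τ : ℝ, 0 ≤ τ → Real.sqrt (Dw N) ≤ 2 * Real.sqrt (Wk N τ) + Real.sqrt (Dl N τ)) ∧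
      (∀ τ : ℝ, 0 ≤ τ → Wk N τ ≤ γ * τ / (4 * T ^ 2)) ∧
      (∃ τ : ℝ, 0 ≤ τ ∧ τ ≤ c * N ∧ Dl N τ ≤ C * N) := by
    intro N hN
    have hN0 : 0 < N := by omega
    obtain ⟨hInv, hMix⟩ := stub_equilibriumKernelFacts ω₂ lam β γ hω hl hβ hγ hU T hT N hN0
    obtain ⟨-, hw2, hwin⟩ := stub_correctorIntegrability ω₂ lam β γ hω hl hβ hγ T hT N hN hInv hMix
    have hCalc := stub_gibbsContactCalculus ω₂ lam β γ hω hl hβ hγ T hT N hN0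
    have hKL := stub_klExpansion ω₂ lam β γ hω hl hβ hγ hU μ hμ T hT N hN hInv hMix hw2
    have hBud := stub_clausiusBudget ω₂ lam β γ hω hl hβ hγ hU T hT N hN hInv hMix hCalc
      (fun τ hτ => (hwin τ hτ).1)
    obtain ⟨τ₀, hτ₀, hτ₀c, hPw2, hL⟩ := hLate N hN hInv hMix
    refine ⟨?_, ?_, ?_, ?_⟩
    · intro ε hε
      simpa only [Dw, dif_pos hN] using hKL ε hε
    · intro τ hτ
      obtain ⟨hk2, hPw2', hident⟩ := hwin τ hτ
      have h := stub_correctorCocycle ω₂ lam β γ hω hl hβ hγ T hT N (w N hN) (k N hN τ) (Pw N hN τ)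
        hw2 hk2 hPw2' hident
      simpa only [Dw, Wk, Dl, dif_pos hN] using h
    · intro τ hτ
      simpa only [Wk, dif_pos hN] using hBud τ hτ
    · exact ⟨τ₀, hτ₀, hτ₀c, by simpa only [Dl, dif_pos hN] using hL⟩
  exact concl_of_parts hω hl hβ hγ hU hμ hT hc Dw Wk Dl hDw hWk hDl
    (fun N hN => (facts N hN).1) (fun N hN => (facts N hN).2.1) (fun N hN => (facts N hN).2.2.1)
    (fun N hN => (facts N hN).2.2.2)

end Summit.AtomisticToContinuum.FouriersLaw.Cruxes.ExtensiveSnapshotIrreversibility.ClausiusBudgetSoundWindow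

end
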